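import Summits.ValiantsHypothesis.ValiantsHypothesis.Theorems.KPlusLogSqLawStaticPathEvents
import Summits.ValiantsHypothesis.ValiantsHypothesis.Theorems.KPlusLogSqLawStaticPathUnique

/-!
# Route «KPlusLogSqLaw» — parametric max-weight independent set on a path: every change of the optimum is carried by an EVENT CROSSING

HONEST FRAMING.  Helper toward the crux `WeakLifting` (item `stmt-ValiantsHypothesis-19561`, route `KPlusLogSqLaw`, cell `pub-symmetroid`,
seat val-sym-lift-p4 g8, 2026-08-27) on the line of its witness-plan stub `stub_tridiagonalSectorB` (tropical twin of the STATIC tridiagonal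
sector = parametric maximum-weight independent set on a path = Eppstein's parametric closure problem on the fence, arXiv:1504.04073).
Sequel of `…StaticPathEvents` (the event test across ONE adjacent transposition) and `…StaticPathUnique` (distinct prefix-sum values ⇒ unique
optimum).  Here the SWEEP: for the block `i+1, …, i+n` with signed prefix-sum lines `S_p(t) = A_p t + B_p` in general position (pairwise
distinct crossing abscissae `τ_{pq} = (B_q - B_p)/(A_p - A_q)` among non-parallel pairs), and two parameters `θ < θ'` at which the `S_p` take
pairwise distinct values: if the optima at `θ` and `θ'` differ, then some pair `p < q` crosses strictly between `θ` and `θ'` AT AN EVENT —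
at the crossing parameter `τ_{pq}`, `p` is the active index of the left fold just below `q` and `q` is a right record
(`exists_event_crossing`).  Tools: the sign form of a comparison of two lines (`L_lt_iff_sign`, `L_lt_iff_of_notMem`), order transfer to the
reversed block on an index range (`rev_order_of_order_ge`), and the transfer of the event conditions from `θ` to the crossing parameter
(`event_at_crossing_of`).  The counting corollary (chains of unique optima are no longer than the number of event crossings they span) is the
next file.  Statements about a path DP; nothing here asserts anything about `WeakLifting`, `TropicalB`, `KPlusLogSqLaw`, the stub in its
window, `MatrixDescartes` (stmt-ValiantsHypothesis-18050) or `VP ≠ VNP`.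
-/

set_option linter.dupNamespace false
set_option autoImplicit false

namespace Summit.ValiantsHypothesis.ValiantsHypothesis.Theorems.KPlusLogSqLaw

open Finset Classical

namespace StaticPathFold

noncomputable section

/-! ## 1. Two lines: the sign form of a comparison and when it persists -/

/-- **sign form**: for non-parallel lines, `L p t < L q t ↔ (a p - a q) · (t - τ) < 0` with `τ = (b q - b p)/(a p - a q)` their crossing
abscissa. [folklore] -/
theorem L_lt_iff_sign (a b : ℕ → ℝ) {p q : ℕ} (hA : a p ≠ a q) (t : ℝ) :
    L a b p t < L a b q t ↔ (a p - a q) * (t - (b q - b p) / (a p - a q)) < 0 := by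
  have hA' : a p - a q ≠ 0 := sub_ne_zero.mpr hA
  have h : (a p - a q) * (t - (b q - b p) / (a p - a q)) = L a b p t - L a b q t := by
    unfold L
    field_simp
    ring
  rw [h, sub_neg]

/-- at the crossing abscissa the two lines take the same value. [folklore] -/
theorem L_eq_at_crossing (a b : ℕ → ℝ) {p q : ℕ} (hA : a p ≠ a q) :
    L a b p ((b q - b p) / (a p - a q)) = L a b q ((b q - b p) / (a p - a q)) := by
  have hA' : a p - a q ≠ 0 := sub_ne_zero.mpr hA
  have h := L_lt_iff_sign a b hA ((b q - b p) / (a p - a q))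
  have h2 : ¬ L a b p ((b q - b p) / (a p - a q)) < L a b q ((b q - b p) / (a p - a q)) := by
    rw [h, sub_self, mul_zero]; exact lt_irrefl 0
  have h' := L_lt_iff_sign a b (Ne.symm hA) ((b p - b q) / (a q - a p))
  have hsymm : (b p - b q) / (a q - a p) = (b q - b p) / (a p - a q) := by
    rw [← neg_sub (b q), ← neg_sub (a p), neg_div_neg_eq]
  rw [hsymm] at h'
  have h3 : ¬ L a b q ((b q - b p) / (a p - a q)) < L a b p ((b q - b p) / (a p - a q)) := by
    rw [h', sub_self, mul_zero]; exact lt_irrefl 0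
  exact le_antisymm (not_lt.mp h3) (not_lt.mp h2)

/-- the crossing abscissa is symmetric in the pair. [folklore] -/
theorem crossing_symm (a b : ℕ → ℝ) (p q : ℕ) : (b p - b q) / (a q - a p) = (b q - b p) / (a p - a q) := by
  rw [← neg_sub (b q), ← neg_sub (a p), neg_div_neg_eq]

/-- **persistence**: two non-parallel lines compare the same way at `t ≤ t'` when their crossing abscissa is outside `[t, t']`. [folklore] -/
theorem L_lt_iff_of_notMem (a b : ℕ → ℝ) {p q : ℕ} (hA : a p ≠ a q) {t t' : ℝ} (htt' : t ≤ t')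
    (hout : (b q - b p) / (a p - a q) < t ∨ t' < (b q - b p) / (a p - a q)) :
    L a b p t < L a b q t ↔ L a b p t' < L a b q t' := by
  rw [L_lt_iff_sign a b hA t, L_lt_iff_sign a b hA t']
  set τ := (b q - b p) / (a p - a q) with hτ
  set u := a p - a q with hu
  -- `t - τ` and `t' - τ` have the same sign
  have hs : 0 < (t - τ) * (t' - τ) := by
    rcases hout with h | h
    · exact mul_pos (by linarith) (by linarith)
    · exact mul_pos_of_neg_of_neg (by linarith) (by linarith)
  constructor
  · intro h1
    by_contra h2
    have h2' : 0 ≤ u * (t' - τ) := not_lt.mp h2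
    have : u * (t - τ) * (u * (t' - τ)) ≤ 0 := mul_nonpos_of_nonpos_of_nonneg h1.le h2'
    have hu0 : u ≠ 0 := sub_ne_zero.mpr hA
    have : 0 < u * (t - τ) * (u * (t' - τ)) := by
      have : u * (t - τ) * (u * (t' - τ)) = u * u * ((t - τ) * (t' - τ)) := by ring
      rw [this]; exact mul_pos (mul_self_pos.mpr hu0) hs
    linarith
  · intro h1
    by_contra h2
    have h2' : 0 ≤ u * (t - τ) := not_lt.mp h2
    have : u * (t' - τ) * (u * (t - τ)) ≤ 0 := mul_nonpos_of_nonpos_of_nonneg h1.le h2'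
    have hu0 : u ≠ 0 := sub_ne_zero.mpr hA
    have : 0 < u * (t' - τ) * (u * (t - τ)) := by
      have : u * (t' - τ) * (u * (t - τ)) = u * u * ((t - τ) * (t' - τ)) := by ring
      rw [this]; exact mul_pos (mul_self_pos.mpr hu0) hs
    linarith

/-- parallel lines compare the same way everywhere. [folklore] -/
theorem L_lt_iff_of_parallel (a b : ℕ → ℝ) {p q : ℕ} (hA : a p = a q) (t t' : ℝ) :
    L a b p t < L a b q t ↔ L a b p t' < L a b q t' := by
  unfold L; rw [hA]; constructor <;> intro h <;> linarith

/-! ## 2. Order transfer to the reversed block on an index range -/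

variable (w₁ w₀ : ℕ → ℝ)

/-- if the prefix-sum lines of indices `k ≤ p, q ≤ n` compare the same way at `t` and `t'`, then the reversed block's prefix-sum lines of levels
`≤ n - k` do. [folklore] -/
theorem rev_order_of_order_ge {i n k : ℕ} (hk : k ≤ n) {t t' : ℝ}
    (h : ∀ p q, k ≤ p → p ≤ n → k ≤ q → q ≤ n →
      (L (altA (shift i w₁)) (altB (shift i w₀)) p t < L (altA (shift i w₁)) (altB (shift i w₀)) q t ↔
        L (altA (shift i w₁)) (altB (shift i w₀)) p t' < L (altA (shift i w₁)) (altB (shift i w₀)) q t')) :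
    ∀ y z, y ≤ n - k → z ≤ n - k →
      (L (altA (shift 0 (rev i n w₁))) (altB (shift 0 (rev i n w₀))) y t < L (altA (shift 0 (rev i n w₁))) (altB (shift 0 (rev i n w₀))) z t ↔
        L (altA (shift 0 (rev i n w₁))) (altB (shift 0 (rev i n w₀))) y t' <
          L (altA (shift 0 (rev i n w₁))) (altB (shift 0 (rev i n w₀))) z t') := by
  intro y z hy hz
  rw [rev_lt_iff w₁ w₀ (by omega) (by omega), rev_lt_iff w₁ w₀ (by omega) (by omega)]
  refine neg_one_pow_mul_lt_iff_of (n + 1) ?_ ?_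
  · exact h (n - z) (n - y) (by omega) (by omega) (by omega) (by omega)
  · exact h (n - y) (n - z) (by omega) (by omega) (by omega) (by omega)

/-! ## 3. Transfer of the event conditions from a nearby parameter to the crossing parameter -/

/-- **event conditions move to the crossing parameter**: if between `θ` and `τ` every pair of prefix-sum lines other than `(α, κ)` keeps its
strict order, then «the active index below `κ` is `α`» and «`κ` is a right record» hold at `τ` iff they hold at `θ`. [folklore] -/
theorem event_iff_of_order {i n α κ : ℕ} (hακ : α < κ) (hκn : κ ≤ n) {θ τ : ℝ}
    (hord : ∀ p q, p ≤ n → q ≤ n → ¬(p = α ∧ q = κ) → ¬(p = κ ∧ q = α) →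
      (L (altA (shift i w₁)) (altB (shift i w₀)) p θ < L (altA (shift i w₁)) (altB (shift i w₀)) q θ ↔
        L (altA (shift i w₁)) (altB (shift i w₀)) p τ < L (altA (shift i w₁)) (altB (shift i w₀)) q τ)) :
    (lab (altA (shift i w₁)) (altB (shift i w₀)) (κ - 1) θ = α ∧
        fold (altA (shift 0 (rev i n w₁))) (altB (shift 0 (rev i n w₀))) (n - κ) θ =
          L (altA (shift 0 (rev i n w₁))) (altB (shift 0 (rev i n w₀))) (n - κ) θ) ↔
      (lab (altA (shift i w₁)) (altB (shift i w₀)) (κ - 1) τ = α ∧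
        fold (altA (shift 0 (rev i n w₁))) (altB (shift 0 (rev i n w₀))) (n - κ) τ =
          L (altA (shift 0 (rev i n w₁))) (altB (shift 0 (rev i n w₀))) (n - κ) τ) := by
  -- levels `≤ κ - 1` only see indices `< κ`
  have h1 : lab (altA (shift i w₁)) (altB (shift i w₀)) (κ - 1) θ = lab (altA (shift i w₁)) (altB (shift i w₀)) (κ - 1) τ :=
    lab_eq_of_order _ _ (n := κ - 1) (fun p q hp hq => hord p q (by omega) (by omega) (fun h => by omega) (fun h => by omega))
      (κ - 1) le_rfl
  -- the reversed levels `≤ n - κ` only see indices `≥ κ`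
  have h2 := fold_eq_L_iff_of_order (altA (shift 0 (rev i n w₁))) (altB (shift 0 (rev i n w₀))) (n := n - κ)
    (rev_order_of_order_ge w₁ w₀ hκn (fun p q hp hpn hq hqn => hord p q hpn hqn (fun h => by omega) (fun h => by omega)))
    (k := n - κ) le_rfl
  rw [h1, h2]

/-! ## 4. The sweep: a change of the optimum is carried by an event crossing -/

/-- **EVERY CHANGE OF THE OPTIMUM IS CARRIED BY AN EVENT CROSSING.**  Block `i+1, …, i+n`, prefix-sum lines `S_p(t) = A_p t + B_p`
(`A = altA (shift i w₁)`, `B = altB (shift i w₀)`); assume pairwise distinct crossing abscissae among non-parallel pairs (general position) and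
pairwise distinct values at `θ < θ'`.  If optimal sets at `θ` and at `θ'` differ, then some pair `p < q ≤ n` of non-parallel lines crosses at a
parameter `τ ∈ (θ, θ')` at which `p` is the active index of the left fold just below `q` and `q` is a right record (the event test of
`…StaticPathEvents`, read at the crossing). [folklore] -/
theorem exists_event_crossing {i n : ℕ} {θ' : ℝ}
    (hgen : ∀ p q p' q', p < q → q ≤ n → p' < q' → q' ≤ n → (p ≠ p' ∨ q ≠ q') →
      altA (shift i w₁) p ≠ altA (shift i w₁) q → altA (shift i w₁) p' ≠ altA (shift i w₁) q' →
      (altB (shift i w₀) q - altB (shift i w₀) p) / (altA (shift i w₁) p - altA (shift i w₁) q) ≠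
        (altB (shift i w₀) q' - altB (shift i w₀) p') / (altA (shift i w₁) p' - altA (shift i w₁) q'))
    (hdis' : ∀ p q, p ≤ n → q ≤ n → p ≠ q →
      L (altA (shift i w₁)) (altB (shift i w₀)) p θ' ≠ L (altA (shift i w₁)) (altB (shift i w₀)) q θ')
    {M' : Finset ℕ} (hM' : M' ∈ indepSets i n) (hopt' : ∑ t ∈ M', W w₁ w₀ t θ' = opt w₁ w₀ i n θ') :
    ∀ (m : ℕ) (θ : ℝ), θ < θ' →
      (∀ p q, p ≤ n → q ≤ n → p ≠ q → L (altA (shift i w₁)) (altB (shift i w₀)) p θ ≠ L (altA (shift i w₁)) (altB (shift i w₀)) q θ) →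
      ((((range (n + 1)) ×ˢ (range (n + 1))).filter (fun pq : ℕ × ℕ => pq.1 < pq.2 ∧ altA (shift i w₁) pq.1 ≠ altA (shift i w₁) pq.2 ∧
          θ < (altB (shift i w₀) pq.2 - altB (shift i w₀) pq.1) / (altA (shift i w₁) pq.1 - altA (shift i w₁) pq.2) ∧
          (altB (shift i w₀) pq.2 - altB (shift i w₀) pq.1) / (altA (shift i w₁) pq.1 - altA (shift i w₁) pq.2) < θ')).card ≤ m) →
      ∀ M : Finset ℕ, M ∈ indepSets i n → ∑ t ∈ M, W w₁ w₀ t θ = opt w₁ w₀ i n θ → M ≠ M' →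
      ∃ p q, p < q ∧ q ≤ n ∧ altA (shift i w₁) p ≠ altA (shift i w₁) q ∧
        θ < (altB (shift i w₀) q - altB (shift i w₀) p) / (altA (shift i w₁) p - altA (shift i w₁) q) ∧
        (altB (shift i w₀) q - altB (shift i w₀) p) / (altA (shift i w₁) p - altA (shift i w₁) q) < θ' ∧
        lab (altA (shift i w₁)) (altB (shift i w₀)) (q - 1)
            ((altB (shift i w₀) q - altB (shift i w₀) p) / (altA (shift i w₁) p - altA (shift i w₁) q)) = p ∧
        fold (altA (shift 0 (rev i n w₁))) (altB (shift 0 (rev i n w₀))) (n - q)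
            ((altB (shift i w₀) q - altB (shift i w₀) p) / (altA (shift i w₁) p - altA (shift i w₁) q)) =
          L (altA (shift 0 (rev i n w₁))) (altB (shift 0 (rev i n w₀))) (n - q)
            ((altB (shift i w₀) q - altB (shift i w₀) p) / (altA (shift i w₁) p - altA (shift i w₁) q)) := by
  -- abbreviations
  set A := altA (shift i w₁) with hAdef
  set B := altB (shift i w₀) with hBdef
  set τ : ℕ × ℕ → ℝ := fun pq => (B pq.2 - B pq.1) / (A pq.1 - A pq.2) with hτ
  intro m
  induction m using Nat.strong_induction_on with
  | _ m ih =>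
  intro θ hθ hdis hcard M hM hopt hne
  set C := ((range (n + 1)) ×ˢ (range (n + 1))).filter
    (fun pq : ℕ × ℕ => pq.1 < pq.2 ∧ A pq.1 ≠ A pq.2 ∧ θ < τ pq ∧ τ pq < θ') with hC
  have hmemC : ∀ pq : ℕ × ℕ, pq ∈ C ↔ pq.1 < pq.2 ∧ pq.2 ≤ n ∧ A pq.1 ≠ A pq.2 ∧ θ < τ pq ∧ τ pq < θ' := by
    intro pq
    rw [hC, mem_filter, mem_product, mem_range, mem_range]
    constructor
    · rintro ⟨⟨h1, h2⟩, h3, h4, h5, h6⟩; exact ⟨h3, by omega, h4, h5, h6⟩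
    · rintro ⟨h3, h2, h4, h5, h6⟩; exact ⟨⟨by omega, by omega⟩, h3, h4, h5, h6⟩
  -- parallel pairs are distinct lines (distinct values at `θ`), hence compare the same way everywhere;
  -- a non-parallel pair not crossing in `[t, t']` compares the same way at `t` and `t'`
  by_cases hCe : C = ∅
  · -- no crossing strictly between `θ` and `θ'`: the order is the same, so the optima agree
    exfalso
    apply hne
    refine eq_of_order w₁ w₀ hM hM' (unique_of_distinct w₁ w₀ hdis hM hopt) (unique_of_distinct w₁ w₀ hdis' hM' hopt') ?_
    intro p q hp hq
    by_cases hApq : A p = A q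
    · exact L_lt_iff_of_parallel A B hApq θ θ'
    · -- the crossing abscissa is not in `[θ, θ']`
      have key : ∀ p q, p < q → q ≤ n → A p ≠ A q → (τ (p, q) < θ ∨ θ' < τ (p, q)) := by
        intro p q hpq hqn hA
        by_contra hh
        push Not at hh
        obtain ⟨h1, h2⟩ := hh
        -- not equal to `θ` or `θ'` (distinct values there), not strictly between (no crossing)
        have hne1 : τ (p, q) ≠ θ := by
          intro he
          apply hdis p q (by omega) hqn (Nat.ne_of_lt hpq)
          have := L_eq_at_crossing A B hA
          simp only [hτ] at he
          rw [he] at this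
          exact this
        have hne2 : τ (p, q) ≠ θ' := by
          intro he
          apply hdis' p q (by omega) hqn (Nat.ne_of_lt hpq)
          have := L_eq_at_crossing A B hA
          simp only [hτ] at he
          rw [he] at this
          exact this
        have hin : (p, q) ∈ C := (hmemC (p, q)).mpr ⟨hpq, hqn, hA, lt_of_le_of_ne h1 (Ne.symm hne1), lt_of_le_of_ne h2 hne2⟩
        rw [hCe] at hin
        exact absurd hin (notMem_empty _)
      rcases lt_trichotomy p q with hpq | rfl | hpq
      · exact L_lt_iff_of_notMem A B hApq hθ.le (key p q hpq hq hApq)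
      · exact absurd rfl hApq
      · have k2 := key q p hpq hp (Ne.symm hApq)
        rw [show τ (q, p) = (B p - B q) / (A q - A p) from rfl, crossing_symm A B] at k2
        exact L_lt_iff_of_notMem A B hApq hθ.le k2
  · -- the first crossing after `θ`
    have hCne : C.Nonempty := nonempty_iff_ne_empty.mpr hCe
    obtain ⟨ak, hakC, hakmin⟩ := exists_min_image C τ hCne
    obtain ⟨hak1, hak2, hakA, hakθ, hakθ'⟩ := (hmemC ak).mp hakC
    set a := ak.1 with ha
    set k := ak.2 with hk
    -- the next cut: the least crossing abscissa after `τ ak`, or `θ'`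
    set C₂ := C.erase ak with hC₂
    set T₂ : Finset ℝ := insert θ' (C₂.image τ) with hT₂
    have hT₂ne : T₂.Nonempty := ⟨θ', mem_insert_self _ _⟩
    set t₂ := T₂.min' hT₂ne with ht₂
    have ht₂θ' : t₂ ≤ θ' := min'_le _ _ (mem_insert_self _ _)
    have ht₂C : ∀ pq ∈ C₂, t₂ ≤ τ pq := fun pq hpq => min'_le _ _ (mem_insert_of_mem (mem_image_of_mem τ hpq))
    -- every other crossing in `(θ, θ')` is strictly later than `τ ak` (distinct abscissae)
    have hlater : ∀ pq ∈ C₂, τ ak < τ pq := by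
      intro pq hpq
      rw [hC₂, mem_erase] at hpq
      obtain ⟨hpq1, hpq2, hpqA, -, -⟩ := (hmemC pq).mp hpq.2
      refine lt_of_le_of_ne (hakmin pq hpq.2) ?_
      have hneq : ak.1 ≠ pq.1 ∨ ak.2 ≠ pq.2 := by
        by_contra hh; push Not at hh; exact hpq.1 (Prod.ext hh.1 hh.2).symm
      exact hgen ak.1 ak.2 pq.1 pq.2 hak1 hak2 hpq1 hpq2 hneq hakA hpqA
    have ht₂gt : τ ak < t₂ := by
      have hmem := min'_mem T₂ hT₂ne
      rw [← ht₂, hT₂, mem_insert, mem_image] at hmem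
      rcases hmem with h | ⟨pq, hpq, h⟩
      · rw [h]; exact hakθ'
      · rw [← h]; exact hlater pq hpq
    -- the sample point between the first two cuts
    set s := (τ ak + t₂) / 2 with hs
    have hs1 : τ ak < s := by rw [hs]; linarith
    have hs2 : s < t₂ := by rw [hs]; linarith
    have hθs : θ < s := hakθ.trans hs1
    have hsθ' : s < θ' := lt_of_lt_of_le hs2 ht₂θ'
    -- no crossing other than `ak` in `(θ, s]`; none at all in `(τ ak, s]`
    have hnoX : ∀ p q, p < q → q ≤ n → A p ≠ A q → (p, q) ≠ ak → (τ (p, q) < θ ∨ s < τ (p, q)) ∨ τ (p, q) = θ := by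
      intro p q hpq hqn hA hne'
      by_cases h1 : τ (p, q) ≤ θ
      · rcases h1.lt_or_eq with h | h
        · exact Or.inl (Or.inl h)
        · exact Or.inr h
      · by_cases h2 : τ (p, q) < θ'
        · have hin : (p, q) ∈ C₂ := by
            rw [hC₂, mem_erase]; exact ⟨hne', (hmemC (p, q)).mpr ⟨hpq, hqn, hA, not_le.mp h1, h2⟩⟩
          exact Or.inl (Or.inr (lt_of_lt_of_le hs2 (ht₂C _ hin)))
        · exact Or.inl (Or.inr (lt_of_lt_of_le hsθ' (not_lt.mp h2)))
    -- values at `θ` are distinct, so no crossing sits exactly at `θ`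
    have hnotθ : ∀ p q, p < q → q ≤ n → A p ≠ A q → τ (p, q) ≠ θ := by
      intro p q hpq hqn hA he
      apply hdis p q (by omega) hqn (Nat.ne_of_lt hpq)
      have := L_eq_at_crossing A B hA
      simp only [hτ] at he
      rw [he] at this
      exact this
    -- comparisons: every pair other than `ak` keeps its order on `[θ, s]`, and on `[θ, τ ak]`
    have hordS : ∀ (t : ℝ), θ ≤ t → t ≤ s → ∀ p q, p ≤ n → q ≤ n → ¬(p = a ∧ q = k) → ¬(p = k ∧ q = a) →
        (L A B p θ < L A B q θ ↔ L A B p t < L A B q t) := by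
      intro t hθt hts p q hp hq h1 h2
      by_cases hApq : A p = A q
      · exact L_lt_iff_of_parallel A B hApq θ t
      rcases lt_trichotomy p q with hpq | rfl | hpq
      · have hne' : (p, q) ≠ ak := fun he => h1 ⟨congrArg Prod.fst he, congrArg Prod.snd he⟩
        rcases hnoX p q hpq hq hApq hne' with (h | h) | h
        · exact L_lt_iff_of_notMem A B hApq hθt (Or.inl h)
        · exact L_lt_iff_of_notMem A B hApq hθt (Or.inr (lt_of_le_of_lt hts h))
        · exact absurd h (hnotθ p q hpq hq hApq)
      · exact absurd rfl hApq
      · have hne' : (q, p) ≠ ak := fun he => h2 ⟨congrArg Prod.snd he, congrArg Prod.fst he⟩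
        rcases hnoX q p hpq hp (Ne.symm hApq) hne' with (h | h) | h
        · rw [show τ (q, p) = (B p - B q) / (A q - A p) from rfl, crossing_symm A B] at h
          exact L_lt_iff_of_notMem A B hApq hθt (Or.inl h)
        · rw [show τ (q, p) = (B p - B q) / (A q - A p) from rfl, crossing_symm A B] at h
          exact L_lt_iff_of_notMem A B hApq hθt (Or.inr (lt_of_le_of_lt hts h))
        · exact absurd h (hnotθ q p hpq hp (Ne.symm hApq))
    -- distinct values at `s`
    have hdisS : ∀ p q, p ≤ n → q ≤ n → p ≠ q → L A B p s ≠ L A B q s := by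
      intro p q hp hq hpq heq
      by_cases hApq : A p = A q
      · -- parallel distinct lines never meet
        apply hdis p q hp hq hpq
        have := (L_lt_iff_of_parallel A B hApq θ s)
        have h2 := (L_lt_iff_of_parallel A B (hApq.symm) θ s)
        rcases lt_trichotomy (L A B p θ) (L A B q θ) with h | h | h
        · exact absurd (this.mp h) (by rw [heq]; exact lt_irrefl _)
        · exact h
        · exact absurd (h2.mp h) (by rw [heq]; exact lt_irrefl _)
      · -- a non-parallel pair meets only at its crossing abscissa, which is not `s`
        have key : ∀ p q, p < q → q ≤ n → A p ≠ A q → L A B p s = L A B q s → False := by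
          intro p q hpq hqn hA heq
          have hsx : s = τ (p, q) := by
            have h1 := L_lt_iff_sign A B hA s
            have h2 := L_lt_iff_sign A B (Ne.symm hA) s
            rw [crossing_symm A B] at h2
            have e1 : ¬ (A p - A q) * (s - τ (p, q)) < 0 := fun h => absurd (h1.mpr h) (by rw [heq]; exact lt_irrefl _)
            have e2 : ¬ (A q - A p) * (s - τ (p, q)) < 0 := fun h => absurd (h2.mpr h) (by rw [heq]; exact lt_irrefl _)
            have hu : A p - A q ≠ 0 := sub_ne_zero.mpr hA
            by_contra hsne
            have hsne' : s - τ (p, q) ≠ 0 := sub_ne_zero.mpr hsne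
            rcases (mul_ne_zero hu hsne').lt_or_gt with h | h
            · exact e1 h
            · apply e2; nlinarith
          by_cases hpqak : (p, q) = ak
          · rw [hpqak] at hsx; linarith
          · rcases hnoX p q hpq hqn hA hpqak with (h | h) | h
            · linarith
            · linarith
            · exact hnotθ p q hpq hqn hA h
        rcases lt_trichotomy p q with h | rfl | h
        · exact key p q h hq hApq heq
        · exact hpq rfl
        · exact key q p h hp (Ne.symm hApq) heq.symm
    -- the optimum at `s`
    obtain ⟨Ms, hMs, hMsopt⟩ := exists_opt_eq w₁ w₀ i n s
    by_cases hch : M = Ms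
    · -- no change up to `s`: recurse on `(s, θ')`, which has fewer crossings
      have hcard' : (((range (n + 1)) ×ˢ (range (n + 1))).filter (fun pq : ℕ × ℕ => pq.1 < pq.2 ∧ A pq.1 ≠ A pq.2 ∧
          s < τ pq ∧ τ pq < θ')).card < m := by
        refine lt_of_lt_of_le ?_ hcard
        apply card_lt_card
        rw [ssubset_iff_of_subset]
        · refine ⟨ak, hakC, ?_⟩
          rw [mem_filter]; push Not; intro _ _ _ h; exact absurd (hs1.trans h) (lt_irrefl _)
        · intro pq hpq
          rw [mem_filter] at hpq
          rw [hC, mem_filter]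
          exact ⟨hpq.1, hpq.2.1, hpq.2.2.1, hθs.trans hpq.2.2.2.1, hpq.2.2.2.2⟩
      obtain ⟨p, q, hpq, hqn, hA, h1, h2, hev⟩ :=
        ih _ hcard' s hsθ' hdisS le_rfl Ms hMs hMsopt.symm (hch ▸ hne)
      exact ⟨p, q, hpq, hqn, hA, hθs.trans h1, h2, hev⟩
    · -- the optimum changes across the single crossing `ak`: it is an event (test of `…StaticPathEvents`), read at `τ ak`
      have hadj : ∀ x, x ≤ n → x ≠ a → x ≠ k → (L A B x θ < L A B a θ ↔ L A B x θ < L A B k θ) := by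
        intro x hx hxa hxk
        -- compare at `τ ak`, where `S a = S k`, and transfer back to `θ`
        have e1 := hordS (τ ak) hakθ.le hs1.le x a hx (by omega) (fun h => hxa h.1) (fun h => hxk h.1)
        have e2 := hordS (τ ak) hakθ.le hs1.le x k hx hak2 (fun h => hxa h.1) (fun h => hxk h.1)
        rw [e1, e2, show L A B a (τ ak) = L A B k (τ ak) from L_eq_at_crossing A B hakA]
      have hev := (ne_iff_event w₁ w₀ hak1 hak2 hM hMs (unique_of_distinct w₁ w₀ hdis hM hopt)
        (unique_of_distinct w₁ w₀ hdisS hMs hMsopt.symm) (fun p q hp hq h1 h2 => hordS s hθs.le le_rfl p q hp hq h1 h2)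
        hdis hdisS hadj).mp hch
      obtain ⟨-, hL, hMid, hR⟩ := hev
      have hlab : lab A B (k - 1) θ = a := (lab_pred_eq_iff A B hak1 θ).mpr ⟨hL, hMid⟩
      have htr := (event_iff_of_order w₁ w₀ hak1 hak2 (τ := τ ak)
        (fun p q hp hq h1 h2 => hordS (τ ak) hakθ.le hs1.le p q hp hq h1 h2)).mp ⟨hlab, hR⟩
      exact ⟨a, k, hak1, hak2, hakA, hakθ, hakθ', htr.1, htr.2⟩

end

end StaticPathFold

end Summit.ValiantsHypothesis.ValiantsHypothesis.Theorems.KPlusLogSqLaw
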